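import Mathlib
import HarnessLib
import Summits.KontsevichZagierPeriods.KontsevichZagierPeriods.Theses.LinRedNormalForm
import Summits.KontsevichZagierPeriods.KontsevichZagierPeriods.Theorems.LinRedNormalFormDihedralNormalFormVertexSplitting
import Literature.NumberTheory.Transcendental.KZCalculus

/-!
# `DihedralNormalForm`, line `torus-descent-sum-shadow`, stub `stub_dilationNL` — tools (Aux 1)

Support file for the stub `stub_dilationNL` (the Euler / dilation Newton–Leibniz move on the
open ordered simplex `Δ = {1 > t₀ > ⋯ > t_k > 0}`) of the crux `DihedralNormalForm`
(stmt-KontsevichZagierPeriods-3912, route `LinRedNormalForm`).  Dimension-free tools: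

* the simplicial Laurent monomial `smono q β γ α t = q · ∏ tᵢ^{βᵢ} (1-tᵢ)^{γᵢ} ∏_{i<j} (tᵢ-tⱼ)^{αᵢⱼ}`,
  the variable part `brkt` of the divergence bracket of the dilation field `D = Σ_{j ≥ m} tⱼ ∂ⱼ`,
  and the logarithmic derivative `logDer` of `smono` in a direction `B`;
* semialgebraicity of `smono ∘ X` for coordinatewise semialgebraic `X`;
* the logarithmic product rule (`hasDerivAt_finset_prod_log`) and the derivative of `smono`
  along an affine path `s ↦ A + s • B` (`hasDerivAt_smono_affine`): `(smono ∘ T)' = (smono ∘ T) · logDer`;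
* the Euler identity `t · logDer x B = brkt x` when `t • B` is the dilated part of `x`
  (`mul_logDer_eq_brkt`);
* the homogeneity of `smono` in the dilated letters (`smono_eq_zpow_mul_smonoQ`): pulling the
  dilation parameter `t` out of the letters `tᵢ` (`i ≥ m`) and `tᵢ - tⱼ` (`m ≤ i < j`) leaves the
  cone monomial `smonoQ`, which is regular at `t = 0`.

References: M. Kontsevich, D. Zagier, *Periods* (2001), §1.2 (rules (2), (3)).
-/

noncomputable section

open MeasureTheory Set

namespace Summit.KontsevichZagierPeriods.DihedralNormalForm.TorusDescent

open Literature.NumberTheory.Transcendental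
open Literature.ModelTheory.ExponentialFields (IsSemialgebraic)

namespace Dilation

variable {n : ℕ}

/-! ### The monomial, the bracket, the logarithmic derivative -/

/-- The simplicial Laurent monomial `q · ∏ tᵢ^{βᵢ} · ∏ (1 - tᵢ)^{γᵢ} · ∏_{i<j} (tᵢ - tⱼ)^{αᵢⱼ}`. -/
def smono (q : ℚ) (β γ : Fin n → ℤ) (α : Fin n → Fin n → ℤ) (t : Fin n → ℝ) : ℝ :=
  (q : ℝ) * ((∏ i, t i ^ β i) * (∏ i, (1 - t i) ^ γ i) *
    ∏ i, ∏ j, if i < j then (t i - t j) ^ α i j else 1)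

/-- The variable part of the divergence bracket of the dilation `D = Σ_{j ≥ m} tⱼ ∂ⱼ` acting on
`log smono`: `Σ_{j ≥ m} βⱼ + Σ_{m ≤ i < j} αᵢⱼ + Σ_{i < m ≤ j} αᵢⱼ (-tⱼ)/(tᵢ - tⱼ) + Σ_{j ≥ m} γⱼ (-tⱼ)/(1 - tⱼ)`. -/
def brkt (m : Fin n) (β γ : Fin n → ℤ) (α : Fin n → Fin n → ℤ) (t : Fin n → ℝ) : ℝ :=
  (∑ j, if m ≤ j then (β j : ℝ) else 0) + (∑ i, ∑ j, if m ≤ i ∧ i < j then (α i j : ℝ) else 0) +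
    (∑ i, ∑ j, if i < m ∧ m ≤ j then (α i j : ℝ) * (-t j) / (t i - t j) else 0) +
    (∑ j, if m ≤ j then (γ j : ℝ) * (-t j) / (1 - t j) else 0)

/-- The logarithmic derivative of `smono` at the point `x` in the direction `B`. -/
def logDer (β γ : Fin n → ℤ) (α : Fin n → Fin n → ℤ) (x B : Fin n → ℝ) : ℝ :=
  (∑ i, (β i : ℝ) * B i / x i) + (∑ i, (γ i : ℝ) * (-B i) / (1 - x i)) +
    ∑ i, ∑ j, if i < j then (α i j : ℝ) * (B i - B j) / (x i - x j) else 0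

/-- The total weight of the dilated letters: `Σ_{j ≥ m} βⱼ + Σ_{m ≤ i < j} αᵢⱼ`. -/
def dilExp (m : Fin n) (β : Fin n → ℤ) (α : Fin n → Fin n → ℤ) : ℤ :=
  (∑ j, if m ≤ j then β j else 0) + ∑ i, ∑ j, if m ≤ i ∧ i < j then α i j else 0

/-- The cone monomial: `smono` with the dilated letters `tᵢ` (`i ≥ m`) and `tᵢ - tⱼ` (`m ≤ i < j`)
read on the cone coordinates `S` (the other letters are read on the point `x`). -/
def smonoQ (m : Fin n) (q : ℚ) (β γ : Fin n → ℤ) (α : Fin n → Fin n → ℤ) (S x : Fin n → ℝ) : ℝ :=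
  (q : ℝ) * ((∏ i, S i ^ β i) * (∏ i, (1 - x i) ^ γ i) *
    ∏ i, ∏ j, if i < j then (if m ≤ i then (S i - S j) else (x i - x j)) ^ α i j else 1)

/-! ### Semialgebraicity -/

/-- `smono ∘ X` is `ℚ`-semialgebraic when the coordinates of `X` are (junk values of `zpow`
included). [cite: BochnakCosteRoy1998, Prop. 2.2.6] -/
theorem isSemialgebraicFunOn_smono_comp {d : ℕ} {W : Set (Fin d → ℝ)} (hW : IsSemialgebraic ℚ W)
    (q : ℚ) (β γ : Fin n → ℤ) (α : Fin n → Fin n → ℤ) {X : (Fin d → ℝ) → (Fin n → ℝ)}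
    (hX : ∀ i, IsSemialgebraicFunOn ℚ W fun x => X x i) :
    IsSemialgebraicFunOn ℚ W fun x => smono q β γ α (X x) := by
  unfold smono
  have h1 : IsSemialgebraicFunOn ℚ W fun _ : Fin d → ℝ => (1 : ℝ) := by
    simpa using isSemialgebraicFunOn_const_ratCast hW 1
  refine (isSemialgebraicFunOn_const_ratCast hW q).fun_mul ?_
  refine IsSemialgebraicFunOn.fun_mul (IsSemialgebraicFunOn.fun_mul ?_ ?_) ?_
  · exact IsSemialgebraicFunOn.fun_finsetProd _ hW fun i _ => fun_zpow (hX i) _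
  · exact IsSemialgebraicFunOn.fun_finsetProd _ hW fun i _ => fun_zpow (h1.fun_sub (hX i)) _
  · refine IsSemialgebraicFunOn.fun_finsetProd _ hW fun i _ => ?_
    refine IsSemialgebraicFunOn.fun_finsetProd _ hW fun j _ => ?_
    by_cases hij : i < j
    · simp only [if_pos hij]
      exact fun_zpow ((hX i).fun_sub (hX j)) _
    · simp only [if_neg hij]
      exact h1

/-! ### The logarithmic product rule -/

/-- Product rule in logarithmic form. [folklore] -/
theorem hasDerivAt_mul_log {f g : ℝ → ℝ} {a b x : ℝ} (hf : HasDerivAt f (f x * a) x)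
    (hg : HasDerivAt g (g x * b) x) :
    HasDerivAt (fun t => f t * g t) (f x * g x * (a + b)) x :=
  (hf.fun_mul hg).congr_deriv (by ring)

/-- Product rule for a finite product in logarithmic form: if `fᵢ' = fᵢ · wᵢ` at `x` then
`(∏ fᵢ)' = (∏ fᵢ) · Σ wᵢ` at `x` (no non-vanishing needed). [folklore] -/
theorem hasDerivAt_finset_prod_log {ι : Type*} (s : Finset ι) {f : ι → ℝ → ℝ} {w : ι → ℝ}
    {x : ℝ} (h : ∀ i ∈ s, HasDerivAt (f i) (f i x * w i) x) :
    HasDerivAt (fun t => ∏ i ∈ s, f i t) ((∏ i ∈ s, f i x) * ∑ i ∈ s, w i) x := by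
  classical
  induction s using Finset.induction_on with
  | empty => simpa using hasDerivAt_const x (1 : ℝ)
  | insert a s ha ih =>
    have h1 := hasDerivAt_mul_log (h a (Finset.mem_insert_self a s))
      (ih fun i hi => h i (Finset.mem_insert_of_mem hi))
    simp only [Finset.prod_insert ha, Finset.sum_insert ha]
    exact h1

/-- An integer power of an affine function, logarithmic form: for `c + x·d ≠ 0`,
`((c + t·d)^N)' = (c + x·d)^N · (N d / (c + x·d))` at `t = x`. [folklore] -/
theorem hasDerivAt_affine_zpow (c d x : ℝ) (N : ℤ) (h : c + x * d ≠ 0) :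
    HasDerivAt (fun t => (c + t * d) ^ N) ((c + x * d) ^ N * (N * d / (c + x * d))) x := by
  have h1 : HasDerivAt (fun t => c + t * d) d x := by
    simpa using ((hasDerivAt_id x).mul_const d).const_add c
  have h2 : HasDerivAt (fun t => (c + t * d) ^ N) ((N : ℝ) * (c + x * d) ^ (N - 1) * d) x := by
    have := (hasDerivAt_zpow N (c + x * d) (Or.inl h)).comp x h1
    exact this
  refine h2.congr_deriv ?_
  rw [zpow_sub_one₀ h]
  field_simp

/-! ### The derivative of the monomial along an affine path -/

/-- **The monomial along an affine path.** For `T s = A + s • B` with all letters of `T x`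
non-degenerate, `s ↦ smono (T s)` has derivative `smono (T x) · logDer (T x) B` at `s = x`.
[folklore] -/
theorem hasDerivAt_smono_affine (q : ℚ) (β γ : Fin n → ℤ) (α : Fin n → Fin n → ℤ)
    (A B : Fin n → ℝ) (x : ℝ)
    (h0 : ∀ i, A i + x * B i ≠ 0) (h1 : ∀ i, 1 - (A i + x * B i) ≠ 0)
    (h2 : ∀ i j, i < j → (A i + x * B i) - (A j + x * B j) ≠ 0) :
    HasDerivAt (fun s => smono q β γ α (A + s • B))
      (smono q β γ α (A + x • B) * logDer β γ α (A + x • B) B) x := by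
  simp only [smono, logDer, Pi.add_apply, Pi.smul_apply, smul_eq_mul]
  have hb1 : HasDerivAt (fun s => ∏ i, (A i + s * B i) ^ β i)
      ((∏ i, (A i + x * B i) ^ β i) * ∑ i, (β i : ℝ) * B i / (A i + x * B i)) x :=
    hasDerivAt_finset_prod_log _ fun i _ => hasDerivAt_affine_zpow (A i) (B i) x (β i) (h0 i)
  have e2 : ∀ s : ℝ, ∀ i, 1 - (A i + s * B i) = (1 - A i) + s * (-B i) := fun s i => by ring
  have hb2 : HasDerivAt (fun s => ∏ i, (1 - (A i + s * B i)) ^ γ i)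
      ((∏ i, (1 - (A i + x * B i)) ^ γ i) * ∑ i, (γ i : ℝ) * (-B i) / (1 - (A i + x * B i))) x := by
    simp only [e2]
    exact hasDerivAt_finset_prod_log _ fun i _ =>
      hasDerivAt_affine_zpow (1 - A i) (-B i) x (γ i) (by rw [← e2]; exact h1 i)
  have e3 : ∀ s : ℝ, ∀ i j, (A i + s * B i) - (A j + s * B j) = (A i - A j) + s * (B i - B j) :=
    fun s i j => by ring
  have hb3 : HasDerivAt
      (fun s => ∏ i, ∏ j, if i < j then ((A i + s * B i) - (A j + s * B j)) ^ α i j else (1:ℝ))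
      ((∏ i, ∏ j, if i < j then ((A i + x * B i) - (A j + x * B j)) ^ α i j else (1:ℝ)) *
        ∑ i, ∑ j, if i < j then (α i j : ℝ) * (B i - B j) / ((A i + x * B i) - (A j + x * B j))
          else 0) x := by
    simp only [e3]
    refine hasDerivAt_finset_prod_log _ fun i _ => hasDerivAt_finset_prod_log _ fun j _ => ?_
    by_cases hij : i < j
    · simp only [if_pos hij]
      exact hasDerivAt_affine_zpow _ _ x (α i j) (by rw [← e3]; exact h2 i j hij)
    · simp only [if_neg hij, mul_zero]
      exact hasDerivAt_const x (1:ℝ)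
  have h := (hasDerivAt_mul_log (hasDerivAt_mul_log hb1 hb2) hb3).const_mul (q : ℝ)
  refine h.congr_deriv ?_
  ring

/-! ### The Euler identity and the homogeneity of the monomial -/

/-- **Euler identity for the bracket.** If the letters of `x` are non-degenerate and `t • B` is the
dilated part of `x` (`t · B i = x i` for `m ≤ i`, `= 0` for `i < m`), then
`t · logDer x B = brkt x`. [folklore] -/
theorem mul_logDer_eq_brkt (m : Fin n) (β γ : Fin n → ℤ) (α : Fin n → Fin n → ℤ)
    (x B : Fin n → ℝ) (t : ℝ) (hB : ∀ i, t * B i = if m ≤ i then x i else 0)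
    (h0 : ∀ i, x i ≠ 0) (h2 : ∀ i j, i < j → x i - x j ≠ 0) :
    t * logDer β γ α x B = brkt m β γ α x := by
  unfold logDer brkt
  have hβ : t * ∑ i, (β i : ℝ) * B i / x i = ∑ j, if m ≤ j then (β j : ℝ) else 0 := by
    rw [Finset.mul_sum]
    refine Finset.sum_congr rfl fun i _ => ?_
    rw [show t * ((β i : ℝ) * B i / x i) = (β i) * (t * B i) / x i by ring, hB i]
    split_ifs
    · field_simp [h0 i]
    · simp
  have hγ : t * ∑ i, (γ i : ℝ) * (-B i) / (1 - x i) =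
      ∑ j, if m ≤ j then (γ j : ℝ) * (-x j) / (1 - x j) else 0 := by
    rw [Finset.mul_sum]
    refine Finset.sum_congr rfl fun i _ => ?_
    rw [show t * ((γ i : ℝ) * (-B i) / (1 - x i)) = (γ i) * (-(t * B i)) / (1 - x i) by ring, hB i]
    split_ifs
    · rfl
    · simp
  have hα : t * ∑ i, ∑ j, (if i < j then (α i j : ℝ) * (B i - B j) / (x i - x j) else 0) =
      (∑ i, ∑ j, if m ≤ i ∧ i < j then (α i j : ℝ) else 0) +
        ∑ i, ∑ j, if i < m ∧ m ≤ j then (α i j : ℝ) * (-x j) / (x i - x j) else 0 := by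
    rw [← Finset.sum_add_distrib, Finset.mul_sum]
    refine Finset.sum_congr rfl fun i _ => ?_
    rw [← Finset.sum_add_distrib, Finset.mul_sum]
    refine Finset.sum_congr rfl fun j _ => ?_
    by_cases hij : i < j
    · rw [if_pos hij, show t * ((α i j : ℝ) * (B i - B j) / (x i - x j)) =
        (α i j) * (t * B i - t * B j) / (x i - x j) by ring, hB i, hB j]
      by_cases hmi : m ≤ i
      · have hmj : m ≤ j := hmi.trans hij.le
        have hn : ¬(i < m ∧ m ≤ j) := fun h => (not_le.2 h.1) hmi
        rw [if_pos hmi, if_pos hmj, if_pos ⟨hmi, hij⟩, if_neg hn, add_zero]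
        field_simp [h2 i j hij]
      · have hn : ¬(m ≤ i ∧ i < j) := fun h => hmi h.1
        rw [if_neg hmi, if_neg hn, zero_add]
        by_cases hmj : m ≤ j
        · rw [if_pos hmj, if_pos ⟨not_le.1 hmi, hmj⟩]
          ring
        · have hn' : ¬(i < m ∧ m ≤ j) := fun h => hmj h.2
          rw [if_neg hmj, if_neg hn']
          simp
    · have hn : ¬(m ≤ i ∧ i < j) := fun h => hij h.2
      have hn' : ¬(i < m ∧ m ≤ j) := fun h => hij (lt_of_lt_of_le h.1 h.2)
      rw [if_neg hij, if_neg hn, if_neg hn', mul_zero, add_zero]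
  rw [mul_add, mul_add, hβ, hγ, hα]
  ring

/-- `∏ (if p i then t ^ N i else 1) = t ^ (Σ if p i then N i else 0)` for `t ≠ 0`. [folklore] -/
theorem prod_ite_zpow {ι : Type*} (s : Finset ι) (p : ι → Prop) [DecidablePred p] (N : ι → ℤ)
    {t : ℝ} (ht : t ≠ 0) :
    ∏ i ∈ s, (if p i then t ^ N i else 1) = t ^ (∑ i ∈ s, if p i then N i else 0) := by
  rw [← prod_zpow_eq_zpow_sum s _ ht]
  refine Finset.prod_congr rfl fun i _ => ?_
  split_ifs <;> simp

/-- **Homogeneity of the monomial in the dilated letters.** If `x i = t · S i` for `m ≤ i` and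
`x i = S i` for `i < m` (`t ≠ 0`), then `smono x = t ^ dilExp · smonoQ S x`. [folklore] -/
theorem smono_eq_zpow_mul_smonoQ (m : Fin n) (q : ℚ) (β γ : Fin n → ℤ)
    (α : Fin n → Fin n → ℤ) (S x : Fin n → ℝ) {t : ℝ} (ht : t ≠ 0)
    (hx : ∀ i, x i = if m ≤ i then t * S i else S i) :
    smono q β γ α x = t ^ dilExp m β α * smonoQ m q β γ α S x := by
  unfold smono smonoQ dilExp
  have e1 : (∏ i, x i ^ β i) = t ^ (∑ j, if m ≤ j then β j else 0) * ∏ i, S i ^ β i := by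
    rw [← prod_ite_zpow _ _ _ ht, ← Finset.prod_mul_distrib]
    refine Finset.prod_congr rfl fun i _ => ?_
    rw [hx i]
    split_ifs <;> simp [mul_zpow]
  have e3 : (∏ i, ∏ j, if i < j then (x i - x j) ^ α i j else (1:ℝ)) =
      t ^ (∑ i, ∑ j, if m ≤ i ∧ i < j then α i j else 0) *
        ∏ i, ∏ j, if i < j then (if m ≤ i then (S i - S j) else (x i - x j)) ^ α i j else 1 := by
    rw [← prod_zpow_eq_zpow_sum _ _ ht, ← Finset.prod_mul_distrib]
    refine Finset.prod_congr rfl fun i _ => ?_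
    rw [← prod_ite_zpow _ _ _ ht, ← Finset.prod_mul_distrib]
    refine Finset.prod_congr rfl fun j _ => ?_
    by_cases hij : i < j
    · by_cases hmi : m ≤ i
      · have hmj : m ≤ j := hmi.trans hij.le
        rw [if_pos hij, if_pos ⟨hmi, hij⟩, if_pos hij, if_pos hmi, hx i, hx j, if_pos hmi, if_pos hmj,
          ← mul_sub, mul_zpow]
      · have hn : ¬(m ≤ i ∧ i < j) := fun h => hmi h.1
        rw [if_pos hij, if_neg hn, if_pos hij, if_neg hmi, one_mul]
    · have hn : ¬(m ≤ i ∧ i < j) := fun h => hij h.2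
      rw [if_neg hij, if_neg hn, if_neg hij, one_mul]
  rw [e1, e3, zpow_add₀ ht]
  ring

end Dilation

/-- **Registered sub-goal `stub_dilationNLAux1`** of `stub_dilationNL` (the logarithmic product rule,
`Dilation.hasDerivAt_finset_prod_log`). [folklore] -/
theorem stub_dilationNLAux1 : ∀ (ι : Type) (s : Finset ι) (f : ι → ℝ → ℝ) (w : ι → ℝ) (x : ℝ), (∀ i ∈ s, HasDerivAt (f i) (f i x * w i) x) → HasDerivAt (fun t => ∏ i ∈ s, f i t) ((∏ i ∈ s, f i x) * ∑ i ∈ s, w i) x :=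
  fun _ s _ _ _ h => Dilation.hasDerivAt_finset_prod_log s h

end Summit.KontsevichZagierPeriods.DihedralNormalForm.TorusDescent
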